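import Summits.QuantumFields.BalabanUV.T4Continuum.Support.NE7CriticalSliceAdapter
import Summits.QuantumFields.BalabanUV.T4Continuum.Support.NE3ClassRadiusFamily
import HarnessLib

/-!
# NE7ConvOneStepSU2 — AT `d = 4`, `L = 2`, SU(2)∕U(2) (`card n = 2`), CLASS RADIUS `0 < ε ≤ 10⁻⁵³`: ONE-STEP ⇐ CRIT-ONE-STEP ∧ REP AND NOTHING ELSE —
# (P♮)_W by row NE3's `NE3ClassRadiusFamily.classSlicePoincare_SU2'` (no numeric hypothesis), the `LevelSmall` family by `levelSmall_family_d4_L2`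
# plus the level-0 line, both BY NAME

Cell `pub-balaban`, rung (B)+1 sub-cell t4, lineage `b2b-balaban-t4-ne7-p1`, generation 66 (CRUX PROVER NE7 #1); hunt (h10) «ONE-STEP = CRIT ∧ CONV»,
memo `t4/b2b-balaban-t4-ne7-p1-g66/HUNT-H10-TWO-ROADS.md` §2.  File F12 (over F10 `NE7CriticalSliceAdapter` p351593; the programme's case `d = 4`).

WHAT ([folklore] composition + two numerals; 0 def, 0 sorry).  **`oneStep_SU2_of_kerCritical_rep`** — `d = 4`, `L = 2`, `card n = 2`, `N ≥ 1`,
`0 < ε ≤ 10⁻⁵³`: the ONE-STEP binder of `NE7InteriorInduction.interior_exists_all_levels` (hence (8)∃ and route 1's (A)-bill at curved data) holds for the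
datum `V` as soon as, for every level `k` and every admissible competitor `U₀` of level `k+1` with `SmallField U₀ (δ(2^k)^{−2})`, there is an admissible `U♯`
with `SmallField U♯ (δ(2^{k+1})^{−2})` that is CRITICAL ON `ker (levelQ' 2 N k U♯)` ([Balaban1985Variational] Thm 1 + Prop. 7 + Sect. F's printed content,
LOCAL reading; by F8 ≡ the Euler–Lagrange system with a coarse multiplier) and over which every admissible `U′` is REPRESENTED (Prop. 2 TYPE: gauge-fixed
`X` with `‖X‖_∞ ≤ α`, `levelAction (U♯e^X) ≤ levelAction U′`, `SmallField (U♯e^X) (ε(2^{k+1})^{−2})`, split `X = X_T + X_N`, `X_T ∈ T_♮(U♯)`, `X_N`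
skew periodic, normal letters `θ_N`, `C_N`) under the numeric line of F4 with the CONSTANT OF RECORD `CP = CPLine 4 2 2 10⁻¹⁷ 10⁻⁵³ + 1` (row NE3-R2's
K-road constant, k-free).  NO Poincaré hypothesis, NO level-smallness hypothesis, NO K-road line remains: they are row NE3's theorems
`NE3ClassRadiusFamily.classSlicePoincare_SU2'` and `levelSmall_family_d4_L2` (+ `LevelSmall 4 2 0 (ε∕4)` by `norm_num`).
SO, FOR THE PROGRAMME's CASE: ONE-STEP ⇐ [kernel] CRIT-ONE-STEP ∧ REP.  HONEST FRAMING (page 1): composition over the two HYPOTHESES CRIT and REP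
(neither proved; CRIT = B11 Sects. B–E over [5] = B9; REP = B8 Thm 2 ∕ B11 Prop. 2 TYPE with route-Π-type normal sizes); NOT ONE-STEP, NOT NE7; spine 0∕9;
finite T⁴ rung (B)+1 — NOT infinite volume, NOT mass gap, NOT Clay.  Continuum YM on T⁴ ⇐ BetaPertH ∧ nine spine estimates (0/9 proved); BetaPertH ⇐ (D1) ∧
(D4) ∧ CAP+tail; G-an2-4 gates asym, D1 and NE2/3/4.
-/

set_option autoImplicit false

open scoped BigOperators Matrix.Norms.L2Operator
open NormedSpace Finset Set

namespace Summit.QuantumFields.BalabanUV.T4Continuum.NE7ConvOneStepSU2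

open Literature.MathematicalPhysics.QuantumFieldTheory.Balaban1983to89
open B7Prop1Explicit B7Prop2Explicit MatrixLog UnitaryModel
open T4AveragingDeficitWall (IsUnitaryCfg IsSkewDir SmallField fineAction vary curl curlSq dirSq)
open T4AveragingDeficitWallBoundary (IsPeriodicCfg periodBox)
open AveragingDeficitPeriodicCounting (IsPeriodicDir)
open AveragingDeficitTorusChart (TDir extDir)
open AveragingDeficitTwoLevelPrep (twoLevelSmall)
open AveragingDeficitMultiLevelPrep (tower LevelSmall levelQ')
open MinimalActionLevels (levelAction perWin)
open MinimalActionSandwich (IsMinimiser admissible)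
open MinimalActionRate (sfClass)
open NE3HessForm (dAction)
open NE3SlicePoincareShape (SlicePoincare slicePoincare_mono)
open NE3FrameFreeSliceW (frameFreeBlockLandauW)
open NE3SlicePoincareBudgetLine (CPLine)
open NE3ClassRadiusFamily (classSlicePoincare_SU2' levelSmall_family_d4_L2 CPLine_nonneg_d4_L2)
open NE7CriticalSliceAdapter (oneStep_of_kerCritical_rep_class)

noncomputable section

variable {n : Type*} [Fintype n] [DecidableEq n]

/-- **THE LEVEL FAMILY AT `d = 4`, `L = 2` INCLUDING LEVEL `0`**: `0 ≤ ε ≤ 10⁻¹¹` ⟹ `LevelSmall 4 2 k (ε∕(2^{k+1})²)` for EVERY `k`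
(`k ≥ 1`: `levelSmall_family_d4_L2`; `k = 0`: `twoLevelSmall 4 2·(ε∕4) ≤ 1` by `norm_num`). [folklore] -/
theorem levelSmall_all_d4_L2 {ε : ℝ} (hε : 0 ≤ ε) (hε' : ε ≤ 1 / 10 ^ 11) :
    ∀ k : ℕ, LevelSmall 4 2 k (ε / (((2 : ℕ) : ℝ) ^ (k + 1)) ^ 2) := by
  intro k
  cases k with
  | zero =>
      show twoLevelSmall 4 2 * (ε / (((2 : ℕ) : ℝ) ^ (0 + 1)) ^ 2) ≤ 1
      unfold twoLevelSmall
      norm_num at hε' ⊢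
      nlinarith
  | succ j => exact levelSmall_family_d4_L2 hε hε' j

/-- **ONE-STEP AT `d = 4`, `L = 2`, SU(2)∕U(2), `0 < ε ≤ 10⁻⁵³`, FROM CRIT-ONE-STEP ON `ker levelQ'` AND REP ONLY.**  See the module docstring. [folklore] -/
theorem oneStep_SU2_of_kerCritical_rep [Nonempty n] (hn : Fintype.card n = 2) {N : ℕ} [NeZero N] (hN : 1 ≤ N) {ε δ : ℝ} (hε : 0 < ε)
    (hε' : ε ≤ 1 / 10 ^ 53) {V : Site 4 → Fin 4 → (Matrix n n ℂ)ˣ}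
    (hcrit : ∀ (k : ℕ) (U₀ : Site 4 → Fin 4 → (Matrix n n ℂ)ˣ), U₀ ∈ admissible (sfClass 4 2 N ε) 2 (k + 1) V →
      SmallField U₀ (δ / (((2 : ℕ) : ℝ) ^ k) ^ 2) →
      ∃ Us : Site 4 → Fin 4 → (Matrix n n ℂ)ˣ, Us ∈ admissible (sfClass 4 2 N ε) 2 (k + 1) V ∧
        SmallField Us (δ / (((2 : ℕ) : ℝ) ^ (k + 1)) ^ 2) ∧
        (∀ Φ : TDir 4 n (2 * tower 2 N k), (∀ r κ, Φ r κ ∈ skewAdjoint (Matrix n n ℂ)) →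
          levelQ' 2 N k Us Φ = 0 → dAction Us (extDir (2 * tower 2 N k) Φ) (perWin 4 (N * 2 ^ (k + 1))) = 0) ∧
        ∀ U' ∈ admissible (sfClass 4 2 N ε) 2 (k + 1) V, ∃ (X XT XN : Site 4 → Fin 4 → Matrix n n ℂ) (α θN CN : ℝ),
          IsSkewDir X ∧ IsPeriodicDir X ((N * 2 ^ (k + 1) : ℕ) : ℤ) ∧ 0 ≤ α ∧ (∀ x μ, ‖X x μ‖ ≤ α) ∧
          levelAction 4 2 N (k + 1) (vary Us X 1) ≤ levelAction 4 2 N (k + 1) U' ∧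
          SmallField (vary Us X 1) (ε / (((2 : ℕ) : ℝ) ^ (k + 1)) ^ 2) ∧
          X = XT + XN ∧ XT ∈ frameFreeBlockLandauW (d := 4) (n := n) 2 N (k + 1) Us ∧ IsSkewDir XN ∧
          IsPeriodicDir XN ((N * 2 ^ (k + 1) : ℕ) : ℤ) ∧
          dirSq XN (periodBox (d := 4) (N * 2 ^ (k + 1))) ≤ θN * dirSq X (periodBox (d := 4) (N * 2 ^ (k + 1))) ∧
          (∑ p ∈ perWin 4 (N * 2 ^ (k + 1)), ‖curl Us XN p‖) ≤ CN * dirSq X (periodBox (d := 4) (N * 2 ^ (k + 1))) ∧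
          2 * (ε / (((2 : ℕ) : ℝ) ^ (k + 1)) ^ 2 * CN)
            ≤ ((((((((2 : ℕ) : ℝ) ^ (k + 1))⁻¹) ^ 2 / (CPLine 4 2 2 (1 / 10 ^ 17) (1 / 10 ^ 53) + 1)) / 4
                - ((((((2 : ℕ) : ℝ) ^ (k + 1))⁻¹) ^ 2 / (CPLine 4 2 2 (1 / 10 ^ 17) (1 / 10 ^ 53) + 1)) / 2 + 16 * (4 : ℕ)) * θN) / 2
                - 576 * (4 : ℕ) * (Real.exp α - 1) ^ 2) / (Fintype.card n : ℝ)
              - 28 * (4 : ℕ) * (ε / (((2 : ℕ) : ℝ) ^ (k + 1)) ^ 2 + 7 * α ^ 2))) :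
    ∀ (k : ℕ) (U₀ : Site 4 → Fin 4 → (Matrix n n ℂ)ˣ), U₀ ∈ admissible (sfClass 4 2 N ε) 2 (k + 1) V →
      SmallField U₀ (δ / (((2 : ℕ) : ℝ) ^ k) ^ 2) →
      ∃ U, IsMinimiser 4 (sfClass 4 2 N ε) 2 N (k + 1) V U ∧ SmallField U (δ / (((2 : ℕ) : ℝ) ^ (k + 1)) ^ 2) := by
  have hP0 := classSlicePoincare_SU2' (n := n) hn hN hε hε'
  have hCP : 0 < CPLine 4 2 2 (1 / 10 ^ 17) (1 / 10 ^ 53) + 1 := by linarith [CPLine_nonneg_d4_L2]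
  have hP : ∀ (j : ℕ) (W : Site 4 → Fin 4 → (Matrix n n ℂ)ˣ), W ∈ sfClass 4 2 N ε (j + 1) →
      SlicePoincare 2 (j + 1) W (frameFreeBlockLandauW 2 N (j + 1) W) (CPLine 4 2 2 (1 / 10 ^ 17) (1 / 10 ^ 53) + 1)
        (periodBox (d := 4) (N * 2 ^ (j + 1))) :=
    fun j W hW => slicePoincare_mono (hP0 j W hW) (by linarith)
  have hls := levelSmall_all_d4_L2 hε.le (hε'.trans (by norm_num))
  exact oneStep_of_kerCritical_rep_class (d := 4) (by norm_num) hN hε.le hCP hls hP hcrit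

end

end Summit.QuantumFields.BalabanUV.T4Continuum.NE7ConvOneStepSU2
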